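import Mathlib
import Summits.KontsevichZagierPeriods.Zeta5Search.XFamilyFPCellsA
import Summits.KontsevichZagierPeriods.Zeta5Search.XFamilyFPCellsB
import Summits.KontsevichZagierPeriods.Zeta5Search.XFamilyFPCellsC
import Summits.KontsevichZagierPeriods.Zeta5Search.XFamilyFPCellsD
import Summits.KontsevichZagierPeriods.Zeta5Search.XFamilyFPCellsE
import Summits.KontsevichZagierPeriods.Zeta5Search.XFamilyFPCellsF
import Summits.KontsevichZagierPeriods.Zeta5Search.XFamilyFPCellsG
import Summits.KontsevichZagierPeriods.Zeta5Search.XFamilyFPCellsH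
import Summits.KontsevichZagierPeriods.Zeta5Search.XFamilyFPCellsI
import Summits.KontsevichZagierPeriods.Zeta5Search.XFamilyFPCellsJ
import Summits.KontsevichZagierPeriods.Zeta5Search.XFamilyFPCellsK
import Summits.KontsevichZagierPeriods.Zeta5Search.ABFamilyFPCellsA
import Summits.KontsevichZagierPeriods.Zeta5Search.ABFamilyFPCellsB
import Summits.KontsevichZagierPeriods.Zeta5Search.ABFamilyFPCellsD
import Summits.KontsevichZagierPeriods.Zeta5Search.ABFamilyFPCellsE
import Summits.KontsevichZagierPeriods.Zeta5Search.TS3RayCellsG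
import Summits.KontsevichZagierPeriods.Zeta5Search.TS3RayCellsH
import Summits.KontsevichZagierPeriods.Zeta5Search.TS3RayCellsI
import Summits.KontsevichZagierPeriods.Zeta5Search.TopFamilyFPCasLB
import Summits.KontsevichZagierPeriods.Zeta5Search.ABFamilyFPCasLB
import Summits.KontsevichZagierPeriods.Zeta5Search.LawA4Proof
import Summits.KontsevichZagierPeriods.Zeta5Search.DenomLaw.PathWeightProfile
import HarnessLib

/-!
# ζ(5) search — the X linear family `n·(3t+13; t+6,…,t)` (census X1, X2): class bound and Lemma-D cells on `(t+2)n < p ≤ (t+12)n`, the DEEP cells by THEOREM L5 / A⁗′ in the frame `(10,[1,−6,−6,1])`, and `C⋆` — ALL `t ≥ 9`, ALL `n`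

Cell `pub-zeta5` (HONEST FRAMING: systematic search; no irrationality claim unless certified), TRACK «DENOM-LAW» D1 prover seat
(denom-prover-d1 g16, `HOME/denom-law/prover-d1/ATTEMPT-16.md` §8).  The X linear family `bLin (t n) (t n + n) n = n·(3t+13; t+6, …, t)` (`b₀ = (3t+13)n`,
`d = (2t+18)n`, pair blocks `(t+2)n, …, (t+12)n`; the dual rays of the census's X-directions: X1 = `t = 16`, X2 = `t = 13`; gen 3 proved the conjugate-raise cell
`(t+1)n < p ≤ (t+2)n`, `DenomLaw/XFamilyCellCR`).  From the machine-generated covers `XFamilyFPCellsA–K` (nine decidable checks coincide LITERALLY with the A/B family's `ABFamFP.checkM_a8/a9`, `checkL5_e3a/e3b` and TOP_STAIR #3's `StairTS3.checkM_c36/c38/c41` — the same type lists — and are cited): §0 kit; §1 `casLB ≥ −13, −11, −11, −9, −7, −5, −3, −1, 0`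
on `(t+3,t+4], (t+4,(3t+13)/3], (t+5,t+6], …, (t+11,t+12]` and the two LEMMA-D cells `(t+2,t+3]`, `((3t+13)/3, t+5]` (`v ≥ −12`, `TopFamFP.cover_J_j`, parity split in
`(t+1)n` on the first); §2 THE DEEP CELLS `(t+12)n < 2p`, `p ≤ (t+2)n` in the SAME frame `(10,[1,−6,−6,1])` as the TOP and A/B families: THEOREM L5 gives `−12` where
`3p ≤ d` (`cas_ge_f3`), THEOREM A⁗′ `−13` where `⌊d/p⌋ = 2` (`cas_ge_f2`); §3 `C⋆ ≤ 10, 9, 8, 7, 6, 5, 4` for `p > (t+2)n, …, (t+8)n`.  Consumed by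
`DenomLaw/XFamilyFPPath`.  Direction `j = 7`.  MODEL/structure-side bookkeeping; nothing about ζ(5); no γ; records in print UNMOVED.
-/

open Finset

namespace Summit.KontsevichZagierPeriods.Zeta5Search.XFamFP

open Summit.KontsevichZagierPeriods.Zeta5Search.ClusterValuation
open Summit.KontsevichZagierPeriods.Zeta5Search.CasoratianValuation (InPolytope shift casoratian pairFloors refund)
open Summit.KontsevichZagierPeriods.Zeta5Search.WedgeDictionary (dOf)
open Summit.KontsevichZagierPeriods.Zeta5Search.ClassTypeCover
open Summit.KontsevichZagierPeriods.Zeta5Search.CellKit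
open Summit.KontsevichZagierPeriods.Zeta5Search.XFam (xf_zero dOf_xf inPolytope_xf inPolytope_shift_xf)
open Summit.KontsevichZagierPeriods.Zeta5Search.StairFLAG (casLB_of_cover')
open Summit.KontsevichZagierPeriods.Zeta5Search.TopFamFP (cover_J_j)
open Summit.KontsevichZagierPeriods.Zeta5Search.ABFamFP (succ_mul_le_of_mul_lt)
open Summit.KontsevichZagierPeriods.Zeta5Search.DenomLaw (cStar checkL5 cover_L5 clausesL5_of_cover)
open Summit.KontsevichZagierPeriods.Zeta5Search.DenomLaw.FirstPeriodKit (cStar_le_of_profile)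
open Summit.KontsevichZagierPeriods.Zeta5Search.RecordWindowsA4 (lawA4_apply)
open Summit.KontsevichZagierPeriods.Zeta5Search.SecondOrder (lawA4_holds)

/-! ## §0 Kit -/

/-- The family's lower parameters: `b_{i+1} = (t + 6 − i)·n` for `i < 7`. -/
theorem xf_param (t n : ℕ) (i : Fin 7) : bLin (t * n) (t * n + n) n (i.val + 1) = ((t : ℤ) + 6 - (i.val : ℤ)) * n := by
  fin_cases i <;> simp [bLin] <;> ring

/-- The family's pair blocks: `b₀ − b_{i+1} − b_{k+1} = (t + i + k + 1)·n`. -/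
theorem xf_block (t n : ℕ) (i k : Fin 7) :
    bLin (t * n) (t * n + n) n 0 - bLin (t * n) (t * n + n) n (i.val + 1) - bLin (t * n) (t * n + n) n (k.val + 1)
      = ((t : ℤ) + i.val + k.val + 1) * n := by
  rw [xf_param, xf_param, xf_zero]; push_cast; ring

/-- Window facts for the first period `(t+12)n < 2p` (`t ≥ 9`, `n ≥ 1`): `5 ≤ p` and `b₀ + 2 < p²` (`p ≥ 11` and `2p ≥ (t+12)n + 1`). -/
theorem window_xf {t n p : ℕ} (ht : 9 * n ≤ t * n) (hn : 1 ≤ n) (hF : t * n + 12 * n < 2 * p) :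
    5 ≤ p ∧ (bLin (t * n) (t * n + n) n 0 + 2 : ℤ) < (p : ℤ) ^ 2 := by
  refine ⟨by omega, ?_⟩
  rw [xf_zero]
  have h1 : ((t * n + 12 * n + 1 : ℕ) : ℤ) ≤ 2 * p := by exact_mod_cast (show t * n + 12 * n + 1 ≤ 2 * p by omega)
  have h2 : (11 : ℤ) ≤ p := by exact_mod_cast (show 11 ≤ p by omega)
  have h3 : (11 : ℤ) * p ≤ (p : ℤ) * p := mul_le_mul_of_nonneg_right h2 (by positivity)
  push_cast at h1 ⊢
  have ht' : (9 : ℤ) * n ≤ t * n := by exact_mod_cast ht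
  nlinarith

/-- `p ≤ d = (2t+18)n`. -/
theorem le_dOf_xf {t n p : ℕ} (h : p ≤ 2 * (t * n) + 18 * n) : (p : ℤ) ≤ dOf (bLin (t * n) (t * n + n) n) := by
  rw [dOf_xf]; exact_mod_cast h

/-- `p ≤ b₀ = (3t+13)n`. -/
theorem le_b0_xf {t n p : ℕ} (h : p ≤ 3 * (t * n) + 13 * n) : (p : ℤ) ≤ bLin (t * n) (t * n + n) n 0 := by
  rw [xf_zero]; exact_mod_cast h

/-- The parity flag of `b₀ = (3t+13)n` for even `(t+1)n`. -/
theorem oddFlag_even {t n : ℕ} (h : (t * n + n) % 2 = 0) : decide (¬ (2 : ℤ) ∣ bLin (t * n) (t * n + n) n 0) = false := by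
  rw [xf_zero, decide_eq_false_iff_not, not_not]
  exact ⟨((3 * (t * n) + 13 * n) / 2 : ℕ), by push_cast; omega⟩

/-- The parity flag of `b₀ = (3t+13)n` for odd `(t+1)n`. -/
theorem oddFlag_odd {t n : ℕ} (h : (t * n + n) % 2 = 1) : decide (¬ (2 : ℤ) ∣ bLin (t * n) (t * n + n) n 0) = true := by
  rw [xf_zero, decide_eq_true_iff]
  intro hd
  omega

/-- `(t+1)n` odd forces `n` odd. -/
theorem n_odd_of {t n : ℕ} (hr : (t * n + n) % 2 = 1) : n % 2 = 1 := by
  have hodd : Odd ((t + 1) * n) := by rw [show (t + 1) * n = t * n + n by ring]; exact Nat.odd_iff.mpr hr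
  exact Nat.odd_iff.mp (Nat.odd_mul.mp hodd).2

/-- **THEOREM LB on the family, direction 7**: `casLB ≤ v_p(Cas₇)` in the first period (`t ≥ 9`). -/
theorem cas_ge_casLB {t n p : ℕ} (ht : 9 * n ≤ t * n) (hn : 1 ≤ n) (hprime : p.Prime) (hF : t * n + 12 * n < 2 * p)
    (hcas : casoratian (bLin (t * n) (t * n + n) n) 7 ≠ 0) :
    casLB (bLin (t * n) (t * n + n) n) p ≤ padicValRat p (casoratian (bLin (t * n) (t * n + n) n) 7) := by
  obtain ⟨hp5, hwin⟩ := window_xf ht hn hF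
  exact casoratianClassBound_holds _ 7 p (inPolytope_xf t n) (by norm_num) le_rfl (inPolytope_shift_xf t hn) hprime hp5 hwin hcas

/-! ## §1 `casLB` and the two Lemma-D cells on `(t+2)n < p ≤ (t+12)n` (all `t ≥ 9`) -/

section Cells
variable {t n p : ℕ} [Fact p.Prime]

/-- `x3`: `casLB ≥ -13`. -/
theorem casLB_x3 (ht : 9 * n ≤ t * n) (hn : 1 ≤ n) (hA : t * n + 3 * n < p) (hB : p ≤ t * n + 4 * n) (hF : t * n + 12 * n < 2 * p) (hp2 : p % 2 = 1) :
    (-13 : ℤ) ≤ casLB (bLin (t * n) (t * n + n) n) p := by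
  rcases casLB_of_cover' (cover_x3 ht hn hA hB hF hp2) (checkM_x3 _) (by norm_num) (fun _ => by norm_num) with ⟨h0, -⟩ | h
  · rw [h0]; norm_num
  · linarith

/-- `x4a`: `casLB ≥ -11`. -/
theorem casLB_x4a (ht : 9 * n ≤ t * n) (hn : 1 ≤ n) (hA : t * n + 4 * n < p) (hB : 3 * p ≤ 3 * (t * n) + 13 * n) (hF : t * n + 12 * n < 2 * p) (hp2 : p % 2 = 1) :
    (-11 : ℤ) ≤ casLB (bLin (t * n) (t * n + n) n) p := by
  rcases casLB_of_cover' (cover_x4a ht hn hA hB hF hp2) (checkM_x4a _) (by norm_num) (fun _ => by norm_num) with ⟨h0, -⟩ | h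
  · rw [h0]; norm_num
  · linarith

/-- `x5`: `casLB ≥ -11`. -/
theorem casLB_x5 (ht : 9 * n ≤ t * n) (hn : 1 ≤ n) (hA : t * n + 5 * n < p) (hB : p ≤ t * n + 6 * n) (hp2 : p % 2 = 1) :
    (-11 : ℤ) ≤ casLB (bLin (t * n) (t * n + n) n) p := by
  rcases casLB_of_cover' (cover_x5 ht hn hA hB hp2) (checkM_x5 _) (by norm_num) (fun _ => by norm_num) with ⟨h0, -⟩ | h
  · rw [h0]; norm_num
  · linarith

/-- `x6`: `casLB ≥ -9`. -/
theorem casLB_x6 (ht : 9 * n ≤ t * n) (hn : 1 ≤ n) (hA : t * n + 6 * n < p) (hB : p ≤ t * n + 7 * n) (hp2 : p % 2 = 1) :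
    (-9 : ℤ) ≤ casLB (bLin (t * n) (t * n + n) n) p := by
  rcases casLB_of_cover' (cover_x6 ht hn hA hB hp2) (checkM_x6 _) (by norm_num) (fun _ => by norm_num) with ⟨h0, -⟩ | h
  · rw [h0]; norm_num
  · linarith

/-- `x7`: `casLB ≥ -7`. -/
theorem casLB_x7 (ht : 9 * n ≤ t * n) (hn : 1 ≤ n) (hA : t * n + 7 * n < p) (hB : p ≤ t * n + 8 * n) (hp2 : p % 2 = 1) :
    (-7 : ℤ) ≤ casLB (bLin (t * n) (t * n + n) n) p := by
  rcases casLB_of_cover' (cover_x7 ht hn hA hB hp2) (ABFamFP.checkM_a8 _) (by norm_num) (fun _ => by norm_num) with ⟨h0, -⟩ | h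
  · rw [h0]; norm_num
  · linarith

/-- `x8`: `casLB ≥ -5`. -/
theorem casLB_x8 (ht : 9 * n ≤ t * n) (hn : 1 ≤ n) (hA : t * n + 8 * n < p) (hB : p ≤ t * n + 9 * n) (hp2 : p % 2 = 1) :
    (-5 : ℤ) ≤ casLB (bLin (t * n) (t * n + n) n) p := by
  rcases casLB_of_cover' (cover_x8 ht hn hA hB hp2) (ABFamFP.checkM_a9 _) (by norm_num) (fun _ => by norm_num) with ⟨h0, -⟩ | h
  · rw [h0]; norm_num
  · linarith

/-- `x9`: `casLB ≥ -3`. -/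
theorem casLB_x9 (ht : 9 * n ≤ t * n) (hn : 1 ≤ n) (hA : t * n + 9 * n < p) (hB : p ≤ t * n + 10 * n) (hp2 : p % 2 = 1) :
    (-3 : ℤ) ≤ casLB (bLin (t * n) (t * n + n) n) p := by
  rcases casLB_of_cover' (cover_x9 ht hn hA hB hp2) (StairTS3.checkM_c36 _) (by norm_num) (fun _ => by norm_num) with ⟨h0, -⟩ | h
  · rw [h0]; norm_num
  · linarith

/-- `x10`: `casLB ≥ -1`. -/
theorem casLB_x10 (ht : 9 * n ≤ t * n) (hn : 1 ≤ n) (hA : t * n + 10 * n < p) (hB : p ≤ t * n + 11 * n) (hp2 : p % 2 = 1) :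
    (-1 : ℤ) ≤ casLB (bLin (t * n) (t * n + n) n) p := by
  rcases casLB_of_cover' (cover_x10 ht hn hA hB hp2) (StairTS3.checkM_c38 _) (by norm_num) (fun h => absurd h (by rw [dOf_xf]; omega)) with ⟨h0, -⟩ | h
  · rw [h0]; norm_num
  · linarith

/-- `x11`: `casLB ≥ 0`. -/
theorem casLB_x11 (ht : 9 * n ≤ t * n) (hn : 1 ≤ n) (hA : t * n + 11 * n < p) (hB : p ≤ t * n + 12 * n) (hp2 : p % 2 = 1) :
    (0 : ℤ) ≤ casLB (bLin (t * n) (t * n + n) n) p := by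
  rcases casLB_of_cover' (cover_x11 ht hn hA hB hp2) (StairTS3.checkM_c41 _) (by norm_num) (fun h => absurd h (by rw [dOf_xf]; omega)) with ⟨h0, -⟩ | h
  · rw [h0]
  · linarith

end Cells

/-- **The Lemma-D cell `(t+2)n < p ≤ (t+3)n`** (first period), all `t ≥ 9`, `n ≥ 1`: `v_p(Cas₇) ≥ −12 = casLB + 1` (`m = −8`; parity split in `(t+1)n`). -/
theorem cas_ge_x2 {t n p : ℕ} (ht : 9 * n ≤ t * n) (hn : 1 ≤ n) (hprime : p.Prime)
    (hA : t * n + 2 * n < p) (hB : p ≤ t * n + 3 * n) (hF : t * n + 12 * n < 2 * p)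
    (hcas : casoratian (bLin (t * n) (t * n + n) n) 7 ≠ 0) :
    (-12 : ℤ) ≤ padicValRat p (casoratian (bLin (t * n) (t * n + n) n) 7) := by
  haveI : Fact p.Prime := ⟨hprime⟩
  have hp2 : p % 2 = 1 := Nat.odd_iff.1 (hprime.odd_of_ne_two (by omega))
  obtain ⟨hp5, hwin⟩ := window_xf ht hn hF
  have hb := inPolytope_xf t n
  have hb' := inPolytope_shift_xf t hn
  rcases Nat.mod_two_eq_zero_or_one (t * n + n) with hr | hr
  · obtain ⟨h1, h2, h3⟩ := checkJ_x2_ev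
    exact cover_J_j hb (by norm_num) le_rfl hb' hprime hp5 (le_b0_xf (by omega)) (le_dOf_xf (by omega)) hwin
      (cover_x2_ev ht hn hA hB hF hp2 hr)
      (by rw [oddFlag_even hr]; exact h1) (by norm_num) (by rw [oddFlag_even hr]; exact h2) (by rw [oddFlag_even hr]; exact h3)
      (by norm_num) (by norm_num) (by norm_num) (by norm_num) hcas
  · have hno : n % 2 = 1 := n_odd_of hr
    obtain ⟨h1, h2, h3⟩ := checkJ_x2_od
    exact cover_J_j hb (by norm_num) le_rfl hb' hprime hp5 (le_b0_xf (by omega)) (le_dOf_xf (by omega)) hwin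
      (cover_x2_od ht hn hA hB hF hp2 hr hno)
      (by rw [oddFlag_odd hr]; exact h1) (by norm_num) (by rw [oddFlag_odd hr]; exact h2) (by rw [oddFlag_odd hr]; exact h3)
      (by norm_num) (by norm_num) (by norm_num) (by norm_num) hcas

/-- **The Lemma-D cell `(3t+13)n < 3p`, `p ≤ (t+5)n`** (first period), all `t ≥ 9`, `n ≥ 1`: `v_p(Cas₇) ≥ −12 = casLB + 1` (`m = −8`). -/
theorem cas_ge_x4b {t n p : ℕ} (ht : 9 * n ≤ t * n) (hn : 1 ≤ n) (hprime : p.Prime)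
    (hA : 3 * (t * n) + 13 * n < 3 * p) (hB : p ≤ t * n + 5 * n) (hF : t * n + 12 * n < 2 * p)
    (hcas : casoratian (bLin (t * n) (t * n + n) n) 7 ≠ 0) :
    (-12 : ℤ) ≤ padicValRat p (casoratian (bLin (t * n) (t * n + n) n) 7) := by
  haveI : Fact p.Prime := ⟨hprime⟩
  have hp2 : p % 2 = 1 := Nat.odd_iff.1 (hprime.odd_of_ne_two (by omega))
  obtain ⟨hp5, hwin⟩ := window_xf ht hn hF
  obtain ⟨h1, h2, h3⟩ := checkJ_x4b (decide (¬ (2 : ℤ) ∣ bLin (t * n) (t * n + n) n 0))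
  exact cover_J_j (inPolytope_xf t n) (by norm_num) le_rfl (inPolytope_shift_xf t hn) hprime hp5 (le_b0_xf (by omega)) (le_dOf_xf (by omega)) hwin
    (cover_x4b ht hn hA hB hF hp2) h1 (by norm_num) h2 h3 (by norm_num) (by norm_num) (by norm_num) (by norm_num) hcas

/-! ## §2 The deep cells `(t+12)n < 2p`, `p ≤ (t+2)n` in the frame `(10, [1,−6,−6,1])` -/

/-- **`⌊d/p⌋ = 3` deep cells** (`(t+12)n < 2p`, `3p ≤ (2t+18)n`, `p ≤ (t+2)n`; three θ-strips with covers from `t ≥ 13, 11, 9`): `v_p(Cas₇) ≥ −12` by THEOREM L5. -/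
theorem cas_ge_f3 {t n p : ℕ} (ht : 9 * n ≤ t * n) (hn : 1 ≤ n) (hprime : p.Prime)
    (hA : t * n + 12 * n < 2 * p) (hB : 3 * p ≤ 2 * (t * n) + 18 * n) (hC : p ≤ t * n + 2 * n)
    (hcas : casoratian (bLin (t * n) (t * n + n) n) 7 ≠ 0) :
    (-12 : ℤ) ≤ padicValRat p (casoratian (bLin (t * n) (t * n + n) n) 7) := by
  haveI : Fact p.Prime := ⟨hprime⟩
  have hp2 : p % 2 = 1 := Nat.odd_iff.1 (hprime.odd_of_ne_two (by omega))
  obtain ⟨hp5, hwin⟩ := window_xf ht hn hA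
  have hb := inPolytope_xf t n
  have hb' := inPolytope_shift_xf t hn
  have hpb : (p : ℤ) ≤ bLin (t * n) (t * n + n) n 0 := le_b0_xf (by omega)
  have hdeg : (p : ℤ) * ((10 : ℕ) - 4 : ℤ) ≤ 2 * dOf (bLin (t * n) (t * n + n) n) + 1 := by
    rw [dOf_xf]; push_cast
    have : (3 * p : ℤ) ≤ 2 * (t * n) + 18 * n := by exact_mod_cast hB
    linarith
  have hT : ([1, -6, -6, 1] : List ℤ).reverse = [1, -6, -6, 1] := by decide
  have go : ∀ {TY : List (List ℤ × Bool)}, Cover (bLin (t * n) (t * n + n) n) p TY →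
      checkL5 (decide (¬ (2 : ℤ) ∣ bLin (t * n) (t * n + n) n 0)) TY 10 [1, -6, -6, 1] = true →
      (-12 : ℤ) ≤ padicValRat p (casoratian (bLin (t * n) (t * n + n) n) 7) :=
    fun hcov hchk => cover_L5 hb hb' (by norm_num) le_rfl hprime hp5 hpb hwin hcov (M := 10) (by norm_num) (by decide) hT hchk hdeg (by norm_num) hcas
  by_cases h1 : p ≤ t * n + n
  · rcases Nat.mod_two_eq_zero_or_one (t * n + n) with hr | hr
    · by_cases h0 : p ≤ t * n
      · have ht13 : 13 * n ≤ t * n := succ_mul_le_of_mul_lt (a := 12) (by omega)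
        exact go (cover_f3a_ev ht13 hn hA hB h0 hp2 hr) (by rw [oddFlag_even hr]; exact ABFamFP.checkL5_e3a_ev)
      · have ht11 : 11 * n ≤ t * n := succ_mul_le_of_mul_lt (a := 10) (by omega)
        exact go (cover_f3b_ev ht11 hn (by omega) hB h1 hA hp2 hr) (by rw [oddFlag_even hr]; exact ABFamFP.checkL5_e3b_ev)
    · have hno : n % 2 = 1 := n_odd_of hr
      by_cases h0 : p ≤ t * n
      · have ht13 : 13 * n ≤ t * n := succ_mul_le_of_mul_lt (a := 12) (by omega)
        exact go (cover_f3a_od ht13 hn hA hB h0 hp2 hr hno) (by rw [oddFlag_odd hr]; exact ABFamFP.checkL5_e3a_od)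
      · have ht11 : 11 * n ≤ t * n := succ_mul_le_of_mul_lt (a := 10) (by omega)
        exact go (cover_f3b_od ht11 hn (by omega) hB h1 hA hp2 hr hno) (by rw [oddFlag_odd hr]; exact ABFamFP.checkL5_e3b_od)
  · exact go (cover_f3c ht hn (by omega) hB hC hA hp2) (checkL5_f3c _)

/-- **`⌊d/p⌋ = 2` deep cell** (`(2t+18)n < 3p`, `p ≤ (t+2)n`, first period; forces `t ≥ 13`): `v_p(Cas₇) ≥ −13` by THEOREM A⁗′ in the frame `(10, [1,−6,−6,1])`. -/
theorem cas_ge_f2 {t n p : ℕ} (hn : 1 ≤ n) (hprime : p.Prime)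
    (hA : 2 * (t * n) + 18 * n < 3 * p) (hB : p ≤ t * n + 2 * n) (hF : t * n + 12 * n < 2 * p)
    (hcas : casoratian (bLin (t * n) (t * n + n) n) 7 ≠ 0) :
    (-13 : ℤ) ≤ padicValRat p (casoratian (bLin (t * n) (t * n + n) n) 7) := by
  haveI : Fact p.Prime := ⟨hprime⟩
  have ht : 13 * n ≤ t * n := succ_mul_le_of_mul_lt (a := 12) (by omega)
  have hp2 : p % 2 = 1 := Nat.odd_iff.1 (hprime.odd_of_ne_two (by omega))
  obtain ⟨hp5, hwin⟩ := window_xf (by omega) hn hF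
  have hb := inPolytope_xf t n
  have hb' := inPolytope_shift_xf t hn
  have hpb : (p : ℤ) ≤ bLin (t * n) (t * n + n) n 0 := le_b0_xf (by omega)
  have hT : ([1, -6, -6, 1] : List ℤ).reverse = [1, -6, -6, 1] := by decide
  rcases Nat.mod_two_eq_zero_or_one (t * n + n) with hr | hr
  · obtain ⟨hCl, -⟩ := clausesL5_of_cover (cover_f2_ev ht hn hA hB hF hp2 hr) (M := 10) (T := [1, -6, -6, 1])
      (by rw [oddFlag_even hr]; exact checkL5_f2_ev)
    have h := lawA4_apply lawA4_holds _ p 7 10 [1, -6, -6, 1] hb hb' (by norm_num) le_rfl hprime hp5 hpb hwin (by norm_num) (by decide) hT hCl hcas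
    push_cast at h; linarith
  · have hno : n % 2 = 1 := n_odd_of hr
    obtain ⟨hCl, -⟩ := clausesL5_of_cover (cover_f2_od ht hn hA hB hF hp2 hr hno) (M := 10) (T := [1, -6, -6, 1])
      (by rw [oddFlag_odd hr]; exact checkL5_f2_od)
    have h := lawA4_apply lawA4_holds _ p 7 10 [1, -6, -6, 1] hb hb' (by norm_num) le_rfl hprime hp5 hpb hwin (by norm_num) (by decide) hT hCl hcas
    push_cast at h; linarith

/-! ## §3 `C⋆` on the family (the profile `i + c < 6` / `c < i + k + 1` does not depend on `t`, `n`) -/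

/-- Profile bound: for `p > (t+c)·n` only parameters with `6 − i > c` and blocks with `i + k + 1 > c` can reach `p`. -/
theorem cStar_xf_le_of {t n p c K : ℕ} (hp : t * n + c * n < p)
    (hdec : ((List.finRange 7).permutations'.all fun l : List (Fin 7) => decide (
      ((univ : Finset (Fin 5)).filter fun s => (l.getD (s.val + 1) 0).val + c < 6).card +
      ((univ : Finset (Fin 6)).filter fun s => c < (l.getD s.val 0).val + (l.getD (s.val + 1) 0).val + 1).card ≤ K)) = true) :
    cStar (bLin (t * n) (t * n + n) n) p ≤ K := by
  have hp' : ((t : ℤ) + c) * n < p := by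
    have h := hp; zify at h; linarith
  have hn0 : (0 : ℤ) ≤ n := by positivity
  refine cStar_le_of_profile (fun i : Fin 7 => i.val + c < 6) (fun i k : Fin 7 => c < i.val + k.val + 1) K ?_ ?_ hdec
  · intro i hi
    rw [xf_param] at hi
    by_contra hc
    push Not at hc
    have hc' : ((t : ℤ) + 6 - (i.val : ℤ)) * n ≤ ((t : ℤ) + c) * n := mul_le_mul_of_nonneg_right (by omega) hn0
    linarith
  · intro i k hik
    rw [xf_block] at hik
    by_contra hc
    push Not at hc
    have hc' : ((t : ℤ) + i.val + k.val + 1) * n ≤ ((t : ℤ) + c) * n := mul_le_mul_of_nonneg_right (by omega) hn0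
    linarith

/-- `C⋆ ≤ 10` for `p > (t+2)n`. -/
theorem cStar_xf_le_ten {t n p : ℕ} (hp : t * n + 2 * n < p) : cStar (bLin (t * n) (t * n + n) n) p ≤ 10 :=
  cStar_xf_le_of hp (by decide +kernel)
/-- `C⋆ ≤ 9` for `p > (t+3)n`. -/
theorem cStar_xf_le_nine {t n p : ℕ} (hp : t * n + 3 * n < p) : cStar (bLin (t * n) (t * n + n) n) p ≤ 9 :=
  cStar_xf_le_of hp (by decide +kernel)
/-- `C⋆ ≤ 8` for `p > (t+4)n`. -/
theorem cStar_xf_le_eight {t n p : ℕ} (hp : t * n + 4 * n < p) : cStar (bLin (t * n) (t * n + n) n) p ≤ 8 :=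
  cStar_xf_le_of hp (by decide +kernel)
/-- `C⋆ ≤ 7` for `p > (t+5)n`. -/
theorem cStar_xf_le_seven {t n p : ℕ} (hp : t * n + 5 * n < p) : cStar (bLin (t * n) (t * n + n) n) p ≤ 7 :=
  cStar_xf_le_of hp (by decide +kernel)
/-- `C⋆ ≤ 6` for `p > (t+6)n`. -/
theorem cStar_xf_le_six {t n p : ℕ} (hp : t * n + 6 * n < p) : cStar (bLin (t * n) (t * n + n) n) p ≤ 6 :=
  cStar_xf_le_of hp (by decide +kernel)
/-- `C⋆ ≤ 5` for `p > (t+7)n`. -/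
theorem cStar_xf_le_five {t n p : ℕ} (hp : t * n + 7 * n < p) : cStar (bLin (t * n) (t * n + n) n) p ≤ 5 :=
  cStar_xf_le_of hp (by decide +kernel)
/-- `C⋆ ≤ 4` for `p > (t+8)n`. -/
theorem cStar_xf_le_four {t n p : ℕ} (hp : t * n + 8 * n < p) : cStar (bLin (t * n) (t * n + n) n) p ≤ 4 :=
  cStar_xf_le_of hp (by decide +kernel)

end Summit.KontsevichZagierPeriods.Zeta5Search.XFamFP
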